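import Literature.AlgebraicGeometry.Modules.CechLocalizedSectionsAffine
import Literature.AlgebraicGeometry.Modules.AffineLocalizing
import Mathlib.AlgebraicGeometry.Morphisms.Flat
import Mathlib.RingTheory.Localization.BaseChange
import HarnessLib

/-!
# The counit `Γ(X, V ⊓ U_α) ⊗_{Γ(X, U_α)} Γ(M, U_α) → Γ(M, V ⊓ U_α)` is bijective for affine-localizing `M`

Companion of `Modules/CechLocalizedSections` / `Modules/CechLocalizedSectionsAffine`. For a family of opens
`𝓤 = (U_i)` of a scheme `X`, a face `U_α = U_{α₀} ∩ ⋯ ∩ U_{αₙ}` and an `𝒪_X`-module `M`, the piece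
`Piece 𝓤 n M V α = Γ(X, V ⊓ U_α) ⊗_{Γ(X, U_α)} Γ(M, U_α)` comes with the counit
`counitPiece : b ⊗ m ↦ b • m|_{V ⊓ U_α}` to `Γ(M, V ⊓ U_α)` (`Modules/CechLocalizedSections`). We prove:

* `counitPiece_bijective_of_inf_face_eq` — if `U_α` is affine, `M` is affine-localizing (quasi-coherent in the
  sense of EGA I 1.4.1 / Hartshorne II 5.3, tree `Modules/AffineLocalizing`) and `V ⊓ U_α = D(g)` is a basic open
  of `U_α`, the counit is bijective: both sides are the localization `Γ(M, U_α)_g` (Hartshorne II Prop. 5.1–5.2: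
  `M̃(D(g)) = M_g`; Mathlib `IsLocalization.tensorProduct_isLocalizedModule` for `A_g ⊗_A N = N_g`);
* `counitPiece_bijective` — the same for every AFFINE `V` with `V ⊓ U_α` affine: glue the basic case over a
  finite cover of `V ⊓ U_α` by opens that are simultaneously basic in `V` and in `U_α`, using the localizing-system
  halves `piece_eq_zero_of_forall_restrict` / `exists_piece_of_compatible` (Stacks 00EK) of the companion file and
  the sheaf property of `M`.

This is the quasi-coherent base change `Γ(X, V ⊓ U_α) ⊗_{Γ(X, U_α)} Γ(M, U_α) = Γ(M, V ⊓ U_α)` (Görtz–Wedhorn II,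
Lemma 22.36 / Stacks 01I8 for the affine morphism `V ⊓ U_α ↪ U_α`), in the section-level vocabulary of the
Čech files. Everything is proved; no named facts, no instances. Mathlib searched (pin v4.32):
`IsLocalization.tensorProduct_isLocalizedModule`, `IsLocalizedModule.linearEquiv`, `IsLocalizedModule.ext`,
`IsAffineOpen.exists_basicOpen_le`, `IsAffineOpen.basicOpen_basicOpen_is_basicOpen`,
`IsAffineOpen.iSup_basicOpen_eq_self_iff`, `TopCat.Sheaf.eq_of_locally_eq'`; there is no Mathlib statement of the
base change for sections of a quasi-coherent module over an affine open subset.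

## References

* R. Hartshorne, *Algebraic Geometry*, GTM 52, Springer (1977): II Prop. 5.1–5.2 (p. 110–111), II Lemma 5.3
  (p. 112). [Hartshorne1977]
* U. Görtz, T. Wedhorn, *Algebraic Geometry II*, Springer Stud. Math. Master (2023), Lemma 22.36 (p. 349),
  Prop. 22.1 (qc base change). [GortzWedhorn2023]
* The Stacks Project, Tag 00EK (localizing systems), Tag 01I8 (quasi-coherent modules on affines). [StacksProject]
-/

noncomputable section

-- `TopCat.Presheaf`/`Scheme.Modules` are not reducible (as in Mathlib's `AlgebraicGeometry/Modules`).
set_option backward.isDefEq.respectTransparency false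

open CategoryTheory AlgebraicGeometry TopologicalSpace Opposite TensorProduct

universe u

namespace Literature.AlgebraicGeometry.Modules

namespace PCech

variable {X : Scheme.{u}} {ι : Type u} (U : ι → X.Opens) (n : ℕ) (M : X.Modules)

/-! ## §1 The three `Γ(X, U_α)`-linear maps: unit, restriction, counit -/

section Linear

variable (V : X.Opens) (α : Fin (n + 1) → ι)

/-- **Restriction `Γ(M, U_α) → Γ(M, V ⊓ U_α)` as a `Γ(X, U_α)`-linear map** (for the restricted action
`targetMod`). [cite: Hartshorne1977, II Prop. 5.2 (p. 110)] -/
def resₗ : Γ(M, face U α) →ₗ[Γ(X, face U α)] Γ(M, V ⊓ face U α) where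
  toFun := Cech.res M (inf_le_right : V ⊓ face U α ≤ face U α)
  map_add' := map_add _
  map_smul' a m := by
    rw [Cech.res_smul, RingHom.id_apply, targetMod_smul_def]

/-- `resₗ` is restriction. [cite: Hartshorne1977, II Prop. 5.2 (p. 110)] -/
@[simp]
theorem resₗ_apply (m : Γ(M, face U α)) :
    resₗ U n M V α m = Cech.res M (inf_le_right : V ⊓ face U α ≤ face U α) m := rfl

/-- **The unit `Γ(M, U_α) → Γ(X, V ⊓ U_α) ⊗ Γ(M, U_α)`, `m ↦ 1 ⊗ m`.** [cite: Hartshorne1977, II Prop. 5.2 (p. 110)] -/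
def unitₗ : Γ(M, face U α) →ₗ[Γ(X, face U α)] Piece U n M V α :=
  TensorProduct.mk Γ(X, face U α) Γ(X, V ⊓ face U α) Γ(M, face U α) 1

/-- `unitₗ m = 1 ⊗ m`. [cite: Hartshorne1977, II Prop. 5.2 (p. 110)] -/
@[simp]
theorem unitₗ_apply (m : Γ(M, face U α)) : unitₗ U n M V α m = tmul (n := n) 1 m := rfl

/-- **The counit as a `Γ(X, U_α)`-linear map** `Γ(X, V ⊓ U_α) ⊗ Γ(M, U_α) → Γ(M, V ⊓ U_α)`.
[cite: GortzWedhorn2023, Lemma 22.36 (p. 349)] -/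
def counitPieceₗ : Piece U n M V α →ₗ[Γ(X, face U α)] Γ(M, V ⊓ face U α) where
  toFun := counitPiece U n M V α
  map_add' := map_add _
  map_smul' a x := by
    rw [RingHom.id_apply, ← algebraMap_smul (Γ(X, V ⊓ face U α)) a x, counitPiece_smul_inf, algebraMap_smul]

/-- `counitPieceₗ` is `counitPiece`. [cite: GortzWedhorn2023, Lemma 22.36 (p. 349)] -/
@[simp]
theorem counitPieceₗ_apply (x : Piece U n M V α) : counitPieceₗ U n M V α x = counitPiece U n M V α x := rfl

/-- `counit ∘ unit = restriction`: `1 • m|_{V ⊓ U_α} = m|_{V ⊓ U_α}`. [cite: GortzWedhorn2023, Lemma 22.36 (p. 349)] -/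
theorem counitPieceₗ_comp_unitₗ : counitPieceₗ U n M V α ∘ₗ unitₗ U n M V α = resₗ U n M V α := by
  ext m
  rw [LinearMap.comp_apply, unitₗ_apply, counitPieceₗ_apply, counitPiece_tmul, one_smul, resₗ_apply]

end Linear

/-! ## §2 The basic case `V ⊓ U_α = D(g)`: both sides are `Γ(M, U_α)_g` -/

section Basic

variable {V : X.Opens} (α : Fin (n + 1) → ι) (g : Γ(X, face U α)) (hW : V ⊓ face U α = X.basicOpen g)
include hW

/-- `g|_{V ⊓ U_α}` is a unit when `V ⊓ U_α = D(g)`. [cite: Hartshorne1977, II Prop. 5.1 (p. 110)] -/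
theorem isUnit_resO_of_inf_face_eq :
    IsUnit (Cech.resO (X := X) (inf_le_right : V ⊓ face U α ≤ face U α) g) := by
  have hu : IsUnit (X.presheaf.map (homOfLE (X.basicOpen_le g)).op g) :=
    X.toRingedSpace.isUnit_res_basicOpen g
  have e : Cech.resO (X := X) (inf_le_right : V ⊓ face U α ≤ face U α) g =
      X.presheaf.map (eqToHom hW).op (X.presheaf.map (homOfLE (X.basicOpen_le g)).op g) := by
    change _ = (X.presheaf.map (homOfLE (X.basicOpen_le g)).op ≫ X.presheaf.map (eqToHom hW).op) g
    rw [← X.presheaf.map_comp, ← op_comp]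
    rfl
  rw [e]
  exact hu.map _

/-- **`Γ(X, V ⊓ U_α) = Γ(X, U_α)_g`** (for the algebra structure `baseAlgebra` = restriction) when `V ⊓ U_α = D(g)`
and `U_α` is affine (Mathlib `IsAffineOpen.isLocalization_basicOpen`, transported along the equality of opens).
[cite: Hartshorne1977, II Prop. 5.1 (p. 110)] -/
theorem isLocalization_away_of_face (hα : IsAffineOpen (face U α)) :
    IsLocalization.Away g Γ(X, V ⊓ face U α) := by
  have hloc := hα.isLocalization_basicOpen g
  let e : Γ(X, X.basicOpen g) ≃+* Γ(X, V ⊓ face U α) :=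
    (X.presheaf.mapIso (eqToIso hW).op).commRingCatIsoToRingEquiv
  refine IsLocalization.isLocalization_of_algEquiv (Submonoid.powers g)
    (AlgEquiv.ofRingEquiv (f := e) fun a => ?_)
  rw [algebraMap_baseAlgebra_apply]
  change (X.presheaf.map (homOfLE (X.basicOpen_le g)).op ≫ X.presheaf.map (eqToHom hW).op) a = _
  rw [← X.presheaf.map_comp, ← op_comp]
  rfl

/-- **The unit `m ↦ 1 ⊗ m` exhibits `Γ(X, V ⊓ U_α) ⊗ Γ(M, U_α)` as `Γ(M, U_α)_g`** when `V ⊓ U_α = D(g)`, `U_α`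
affine (`A_g ⊗_A N = N_g`, Mathlib `IsLocalization.tensorProduct_isLocalizedModule`).
[cite: Hartshorne1977, II Prop. 5.2 (p. 110)] [cite: StacksProject, Tag 00EK] -/
theorem isLocalizedModule_unitₗ (hα : IsAffineOpen (face U α)) :
    IsLocalizedModule (Submonoid.powers g) (unitₗ U n M V α) := by
  haveI := isLocalization_away_of_face U n α g hW hα
  exact IsLocalization.tensorProduct_isLocalizedModule (Submonoid.powers g) Γ(X, V ⊓ face U α)

/-- **Restriction exhibits `Γ(M, V ⊓ U_α)` as `Γ(M, U_α)_g`** when `V ⊓ U_α = D(g)`, `U_α` affine and `M`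
affine-localizing (Hartshorne II Lemma 5.3 in `IsLocalizedModule` form, for an open EQUAL to a basic open).
[cite: Hartshorne1977, II Lemma 5.3 (p. 112)] -/
theorem isLocalizedModule_resₗ (hα : IsAffineOpen (face U α)) (hM : IsAffineLocalizing M) :
    IsLocalizedModule (Submonoid.powers g) (resₗ U n M V α) := by
  have hle : V ⊓ face U α ≤ face U α := inf_le_right
  constructor
  · rintro ⟨_, k, rfl⟩
    obtain ⟨v, hv⟩ := (isUnit_resO_of_inf_face_eq U n α g hW).pow k
    refine ⟨⟨algebraMap _ (Module.End Γ(X, face U α) Γ(M, V ⊓ face U α)) (g ^ k),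
      (v⁻¹ : (Γ(X, V ⊓ face U α))ˣ) • LinearMap.id, ?_, ?_⟩, rfl⟩
    · ext m
      change g ^ k • ((↑v⁻¹ : Γ(X, V ⊓ face U α)) • m) = m
      rw [targetMod_smul_def, map_pow, ← hv, smul_smul, Units.mul_inv, one_smul]
    · ext m
      change (↑v⁻¹ : Γ(X, V ⊓ face U α)) • (g ^ k • m) = m
      rw [targetMod_smul_def, map_pow, ← hv, smul_smul, Units.inv_mul, one_smul]
  · intro s
    obtain ⟨k, x, hx⟩ := hM.numerator hα g hW s
    refine ⟨⟨x, ⟨g ^ k, k, rfl⟩⟩, ?_⟩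
    change g ^ k • s = Cech.res M hle x
    rw [targetMod_smul_def, map_pow]
    rw [Subsingleton.elim (homOfLE (hW.trans_le (X.basicOpen_le g))) (homOfLE hle)] at hx
    exact hx.symm
  · intro x₁ x₂ h
    have h0 : M.presheaf.map (homOfLE hle).op (x₁ - x₂) = 0 := by
      rw [map_sub, sub_eq_zero]; exact h
    obtain ⟨k, hk⟩ := hM.torsion hα g _ hle hW.ge h0
    refine ⟨⟨g ^ k, k, rfl⟩, ?_⟩
    change g ^ k • x₁ = g ^ k • x₂
    rw [← sub_eq_zero, ← smul_sub, hk]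

/-- **Basic case: the counit `Γ(X, V ⊓ U_α) ⊗_{Γ(X, U_α)} Γ(M, U_α) → Γ(M, V ⊓ U_α)` is BIJECTIVE when
`V ⊓ U_α = D(g)` is a basic open of the affine `U_α` and `M` is affine-localizing** — both sides are the
localization `Γ(M, U_α)_g` and the counit is the comparison of localizations.
[cite: Hartshorne1977, II Prop. 5.1–5.2 (p. 110)] [cite: GortzWedhorn2023, Lemma 22.36 (p. 349)] -/
theorem counitPiece_bijective_of_inf_face_eq (hα : IsAffineOpen (face U α)) (hM : IsAffineLocalizing M) :
    Function.Bijective (counitPiece U n M V α) := by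
  haveI := isLocalizedModule_unitₗ U n M α g hW hα
  haveI := isLocalizedModule_resₗ U n M α g hW hα hM
  let e := IsLocalizedModule.linearEquiv (Submonoid.powers g) (unitₗ U n M V α) (resₗ U n M V α)
  have he : counitPieceₗ U n M V α = e.toLinearMap := by
    refine IsLocalizedModule.ext (Submonoid.powers g) (unitₗ U n M V α)
      (IsLocalizedModule.map_units (resₗ U n M V α)) ?_
    rw [counitPieceₗ_comp_unitₗ]
    ext m
    rw [LinearMap.comp_apply, LinearEquiv.coe_coe, IsLocalizedModule.linearEquiv_apply]
  change Function.Bijective (counitPieceₗ U n M V α)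
  rw [he]
  exact e.bijective

end Basic

/-! ## §3 The general case: `V` affine with `V ⊓ U_α` affine -/

section General

variable {V : X.Opens} (α : Fin (n + 1) → ι)

/-- **Simultaneous refinement**: every point of `V ⊓ U_α` (`V`, `U_α` affine) has a neighbourhood `D(h) ⊆ V ⊓ U_α`
with `h ∈ Γ(X, V)` which is ALSO a basic open `D(g')` of `U_α` (a basic open of a basic open of `U_α` is basic,
Mathlib `IsAffineOpen.basicOpen_basicOpen_is_basicOpen`). [cite: Hartshorne1977, II Prop. 5.1 (p. 110)]
[cite: StacksProject, Tag 00EK] -/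
theorem exists_basicOpen_basicOpen (hα : IsAffineOpen (face U α)) (hV : IsAffineOpen V)
    (p : X) (hp : p ∈ V ⊓ face U α) :
    ∃ (h : Γ(X, V)) (g' : Γ(X, face U α)), p ∈ X.basicOpen h ∧ X.basicOpen h ≤ V ⊓ face U α ∧
      X.basicOpen g' = X.basicOpen h := by
  have hp' := Opens.mem_inf.mp hp
  obtain ⟨g, hgW, hpg⟩ := hα.exists_basicOpen_le (V := V ⊓ face U α) ⟨p, hp⟩ hp'.2
  obtain ⟨h, hhg, hph⟩ := hV.exists_basicOpen_le (V := X.basicOpen g) ⟨p, hpg⟩ hp'.1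
  have hgV : X.basicOpen g ≤ V := hgW.trans inf_le_left
  obtain ⟨g', hg'⟩ := hα.basicOpen_basicOpen_is_basicOpen g (X.presheaf.map (homOfLE hgV).op h)
  refine ⟨h, g', hph, hhg.trans hgW, ?_⟩
  rw [hg', Scheme.basicOpen_res]
  exact inf_eq_right.mpr hhg

/-- **The counit `Γ(X, V ⊓ U_α) ⊗_{Γ(X, U_α)} Γ(M, U_α) → Γ(M, V ⊓ U_α)` is BIJECTIVE for `V`, `U_α`, `V ⊓ U_α`
affine and `M` affine-localizing** (quasi-coherent base change along the affine open immersion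
`V ⊓ U_α ↪ U_α`): glue the basic case `counitPiece_bijective_of_inf_face_eq` over a finite cover of `V ⊓ U_α` by
opens `D(h_τ)`, `h_τ ∈ Γ(X, V)`, that are basic in `U_α`, using the two halves of Stacks 00EK for the pieces
(`piece_eq_zero_of_forall_restrict`, `exists_piece_of_compatible`) and the sheaf property of `M`.
[cite: GortzWedhorn2023, Lemma 22.36 (p. 349)] [cite: Hartshorne1977, II Prop. 5.1–5.2 (p. 110)]
[cite: StacksProject, Tag 00EK] -/
theorem counitPiece_bijective (hα : IsAffineOpen (face U α)) (hV : IsAffineOpen V)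
    (hVα : IsAffineOpen (V ⊓ face U α)) (hM : IsAffineLocalizing M) :
    Function.Bijective (counitPiece U n M V α) := by
  -- Step 0: the simultaneous refinement, pointwise on `V ⊓ U_α`
  have H := fun p : ↥(V ⊓ face U α) => exists_basicOpen_basicOpen U n α hα hV p p.2
  choose hp g'p hmem hle heq using H
  -- Step 1: a finite subfamily whose restrictions to `V ⊓ U_α` generate the unit ideal
  have hgp : ∀ p : ↥(V ⊓ face U α), (p : X) ∈ X.basicOpen
      (X.presheaf.map (homOfLE (inf_le_left : V ⊓ face U α ≤ V)).op (hp p)) := fun p => by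
    rw [Scheme.basicOpen_res]
    exact ⟨p.2, hmem p⟩
  obtain ⟨T, hT, hspan⟩ := exists_finset_span_eq_top hVα _ hgp
  haveI : Finite (↑T : Set Γ(X, V ⊓ face U α)) := T.finite_toSet.to_subtype
  have hTp : ∀ τ : (↑T : Set Γ(X, V ⊓ face U α)), ∃ p : ↥(V ⊓ face U α),
      X.presheaf.map (homOfLE (inf_le_left : V ⊓ face U α ≤ V)).op (hp p) = τ := fun τ => hT τ.2
  choose pτ hpτ using hTp
  -- the finite family of functions on `V`, their traces on `U_α`, and generation
  let g : (↑T : Set Γ(X, V ⊓ face U α)) → Γ(X, V) := fun τ => hp (pτ τ)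
  have hgface : ∀ τ, X.basicOpen (g τ) ⊓ face U α = X.basicOpen (g'p (pτ τ)) := fun τ => by
    rw [heq]
    exact inf_eq_left.mpr ((hle (pτ τ)).trans inf_le_right)
  have hrange : Set.range (resFamily U n α g) = ↑T := by
    ext t
    constructor
    · rintro ⟨τ, rfl⟩
      change X.presheaf.map (homOfLE (inf_le_left : V ⊓ face U α ≤ V)).op (hp (pτ τ)) ∈ (↑T : Set _)
      rw [hpτ]
      exact τ.2
    · intro ht
      exact ⟨⟨t, ht⟩, hpτ ⟨t, ht⟩⟩
  have hg : Ideal.span (Set.range (resFamily U n α g)) = ⊤ := by rw [hrange]; exact hspan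
  -- the basic case on `D(g_τ)` and on `D(g_τ g_τ')`
  have hbij₁ : ∀ τ, Function.Bijective (counitPiece U n M (X.basicOpen (g τ)) α) := fun τ =>
    counitPiece_bijective_of_inf_face_eq U n M α (g'p (pτ τ)) (hgface τ) hα hM
  have hbij₂ : ∀ τ τ', Function.Bijective (counitPiece U n M (X.basicOpen (g τ * g τ')) α) := fun τ τ' =>
    counitPiece_bijective_of_inf_face_eq U n M α (g'p (pτ τ) * g'p (pτ τ')) (by
      rw [Scheme.basicOpen_mul, Scheme.basicOpen_mul, ← hgface, ← hgface, inf_inf_distrib_right]) hα hM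
  refine ⟨fun x y hxy => ?_, fun s => ?_⟩
  · -- injectivity: `z` with `counit z = 0` vanishes on every `D(g_τ)` (basic case), hence is zero (00EK)
    rw [← sub_eq_zero] at hxy ⊢
    rw [← map_sub] at hxy
    generalize x - y = z at hxy ⊢
    refine piece_eq_zero_of_forall_restrict U n M (g := g) hVα hg z fun τ => (hbij₁ τ).1 ?_
    rw [map_zero, ← res_counitPiece, hxy, map_zero]
  · -- surjectivity: local lifts on the `D(g_τ)` (basic case) ...
    have hc : ∀ τ, ∃ c : Piece U n M (X.basicOpen (g τ)) α, counitPiece U n M _ α c =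
        Cech.res M (inf_le_inf_right (face U α) (X.basicOpen_le (g τ))) s := fun τ => (hbij₁ τ).2 _
    choose c hcs using hc
    have h₁ : ∀ τ τ' : (↑T : Set Γ(X, V ⊓ face U α)), X.basicOpen (g τ * g τ') ≤ X.basicOpen (g τ) :=
      fun τ τ' => by rw [Scheme.basicOpen_mul]; exact inf_le_left
    have h₂ : ∀ τ τ' : (↑T : Set Γ(X, V ⊓ face U α)), X.basicOpen (g τ * g τ') ≤ X.basicOpen (g τ') :=
      fun τ τ' => by rw [Scheme.basicOpen_mul]; exact inf_le_right
    -- ... agree on the `D(g_τ g_τ')` (basic case, injectivity) ...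
    have hcompat : ∀ τ τ', restrictPiece U n M (h₁ τ τ') α (c τ) = restrictPiece U n M (h₂ τ τ') α (c τ') := by
      intro τ τ'
      apply (hbij₂ τ τ').1
      rw [← res_counitPiece, ← res_counitPiece, hcs, hcs, Cech.res_res, Cech.res_res]
    -- ... so glue (00EK) ...
    obtain ⟨x, hx⟩ := exists_piece_of_compatible U n M (g := g) hVα hg c hcompat
    refine ⟨x, ?_⟩
    -- ... and `counit x = s`, both agreeing on the cover `(D(g_τ) ⊓ U_α)_τ` of `V ⊓ U_α`
    have hcover : V ⊓ face U α ≤ ⨆ τ : (↑T : Set Γ(X, V ⊓ face U α)), X.basicOpen (g τ) ⊓ face U α := by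
      intro p hpV
      have hp' : p ∈ ⨆ τ : (↑T : Set Γ(X, V ⊓ face U α)), X.basicOpen (τ : Γ(X, V ⊓ face U α)) := by
        rw [hVα.iSup_basicOpen_eq_self_iff.mpr hspan]
        exact hpV
      obtain ⟨τ, hτ⟩ := Opens.mem_iSup.mp hp'
      rw [← hpτ τ, Scheme.basicOpen_res] at hτ
      exact Opens.mem_iSup.mpr ⟨τ, ⟨(Opens.mem_inf.mp hτ).2, (Opens.mem_inf.mp hpV).2⟩⟩
    refine TopCat.Sheaf.eq_of_locally_eq' (Cech.abSheaf M)
      (fun τ : (↑T : Set Γ(X, V ⊓ face U α)) => X.basicOpen (g τ) ⊓ face U α) (V ⊓ face U α)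
      (fun τ => homOfLE (inf_le_inf_right (face U α) (X.basicOpen_le (g τ)))) hcover _ _ fun τ => ?_
    change Cech.res M (inf_le_inf_right (face U α) (X.basicOpen_le (g τ))) (counitPiece U n M V α x) =
      Cech.res M (inf_le_inf_right (face U α) (X.basicOpen_le (g τ))) s
    rw [res_counitPiece (h := X.basicOpen_le (g τ)), hx, hcs]

end General

/-! ## §4 Flatness of `Γ(X, V ⊓ U_α)` over `Γ(X, U_α)` -/

section Flat

variable (V : X.Opens) (α : Fin (n + 1) → ι)

/-- **`Γ(X, V ⊓ U_α)` is FLAT over `Γ(X, U_α)`** (for the restriction algebra structure `baseAlgebra`) when `U_α`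
and `V ⊓ U_α` are affine: the open immersion `V ⊓ U_α ↪ U_α` of affine schemes is flat (Mathlib: open immersions
are `Flat`, and `Flat` has the ring-hom property `RingHom.Flat` on affine opens, `HasRingHomProperty.appLE`).
[cite: Hartshorne1977, III Prop. 9.2 (a) (p. 254)] -/
theorem flat_base (hα : IsAffineOpen (face U α)) (hVα : IsAffineOpen (V ⊓ face U α)) :
    Module.Flat Γ(X, face U α) Γ(X, V ⊓ face U α) := by
  have h := HasRingHomProperty.appLE @Flat (𝟙 X) inferInstance ⟨face U α, hα⟩ ⟨V ⊓ face U α, hVα⟩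
    (inf_le_right : V ⊓ face U α ≤ face U α)
  have e : algebraMap Γ(X, face U α) Γ(X, V ⊓ face U α) =
      ((𝟙 X : X ⟶ X).appLE (face U α) (V ⊓ face U α) (inf_le_right : V ⊓ face U α ≤ face U α)).hom := by
    ext a
    rw [algebraMap_baseAlgebra_apply, Scheme.Hom.appLE, Scheme.Hom.id_app, Category.id_comp]
  rw [← RingHom.flat_algebraMap_iff, e]
  exact h

end Flat

end PCech

end Literature.AlgebraicGeometry.Modules

end
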